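import Literature.NumberTheory.LFunctions.Zhang2022.DHMenuConsistentStripCount
import Literature.NumberTheory.LFunctions.Zhang2022.DHMenuConsistentP4B
import Literature.NumberTheory.LFunctions.Zhang2022.DHMenuConsistentRow04Low

/-!
# B-DH-W, row S2 (monotone counts) of `Zhang2022.DH.MenuConsistent` for the (A)-world `W(D, χ)`, PROVED —
# the hypothesis `hS2` of `DHMenuConsistentP4B.menuConsistent_of_fenceRows` (cell `landau-siegel`, §E barrier
# extension, stub S-E-p5-4; KILL(B-dh) of record «inside Σ_menu GIVEN E-057», director-frontier 2026-08-26T19:31:07Z)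

Topic `Literature/NumberTheory/LFunctions/Zhang2022` (namespace `Literature.NumberTheory.LFunctions.Zhang2022.DH`),
companion of `DHChainBarrier.lean` (ls-Bdh-typer-2: `ZeroWorld`, `Menu`, `world`, `MenuConsistent` = registry E-057),
`DHMenuConsistentP4B.lean` (ls-Bdh-typer-1: `menuConsistent_of_fenceRows (h04) (h13) (hS2) : MenuConsistent`, the
`Menu` constructor assembled from the landed field theorems with the three fence-counting fields as hypotheses) and
ls-barrier-p4's fence files `DHMenuConsistentWorld` / `DHMenuConsistentFence` / `DHMenuConsistentStripCount`
(`fenceOrdinate_pos`, `fenceCount`, `fenceBelow`, `mem_fenceBelow_iff`). Proof map of record: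
`pub/landau-siegel/B-dh/SIGMA-E-HANDOVER.md` v1 row S2 («finsum over nested FINITE sets with nonneg weights; (W7)
finiteness»). Everything here is PROVED; no named fact, no `L`-function, no numeric certificate.

**What is proved.** `world_rowS2`: for EVERY `D`, `χ`, level `q` (including `q = 0`), character `ψ`, and
`σ′ ≤ σ`, `T ≤ T′`: `N_W(T, ψ) ≤ N_W(T′, ψ)` (`ZeroWorld.stripCount`) and the box count `ZeroWorld.charZeroCountRe` is
monotone in the height and anti-monotone in `σ` — the field `Menu.rowS2` verbatim; and `world_rowS2_hS2`, the same in the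
exact binder shape of the hypothesis `hS2` of `menuConsistent_of_fenceRows` (its `log D ≥ 43 250` binder is not needed
and not used). Mechanism: the zeros of a slot of `W(D, χ)` of height `≤ T` lie in the finite set «fence of the
conductor below `T`» ∪ `{β₁, 1 − β₁}` (`fence_height_le_finite`: for conductor `f ≥ 1` and `T ≥ 0` this is p4's
`fenceBelow f (fenceCount f T)` by `mem_fenceBelow_iff`; for `T < 0` it is empty; for `f = 0` — level `q = 0` only — the
fence degenerates to the single point `½`, `fenceOrdinate_level_zero`), so both counts are `Finset` sums of the
natural-number multiplicity over NESTED finite sets (`finsum_mem_eq_finite_toFinset_sum`,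
`Finset.sum_le_sum_of_subset_of_nonneg`). With this file and `DHMenuConsistentRow04Low.world_row04` (row 04, landed) the hypotheses of
`menuConsistent_of_fenceRows` reduce to the single row 13 (ls-barrier-p4): `menuConsistent_of_row13`.

WHAT THIS IS NOT: not `menuConsistent_holds` itself; no statement about any actual `L`-function; no verdict. «The
programme SEARCHES and TYPES; no claim about Landau–Siegel zeros, Theorems 1–2 of arXiv:2211.02515 or a repaired
Margin232 until a kernel theorem says so.»

## References

* `pub/landau-siegel/B-dh/SIGMA-E-HANDOVER.md` v1 (row S2, fact W7), `B-dh/KILL-draft.md` v1.4.4, `barrier/ASSIGNMENTS.md`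
  row S-E-p5-4; [Zhang2022LandauSiegel] §2 Assumption (A); [BennettMartinOBryantRechnitzer2021] Thm. 1.1 (the
  Riemann–von Mangoldt count whose main term indexes the fence); [ThornerZaman2024LogFree] §1 (1.2) (the box counts).
-/

noncomputable section

open scoped Classical
open Complex

namespace Literature.NumberTheory.LFunctions.Zhang2022.DH

/-! ### 1. Finiteness of the fence below a height (every conductor, every height) -/

/-- At "conductor" `0` (level `q = 0` only) every fence ordinate vanishes: the defining set
`{T ≥ 0 : 2n+1 ≤ F_0(T)}` is empty since `F_0 ≡ 0` (`log 0 = 0`), and `sInf ∅ = 0`.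
[cite: BennettMartinOBryantRechnitzer2021, Theorem 1.1] -/
theorem fenceOrdinate_level_zero (n : ℕ) : fenceOrdinate 0 (n + 1) = 0 := by
  unfold fenceOrdinate
  have he : {T : ℝ | 0 ≤ T ∧ (2 * ((n + 1 : ℕ) : ℝ) - 1) ≤ rvmMain 0 T} = ∅ := by
    refine Set.eq_empty_of_forall_notMem fun T hT => ?_
    obtain ⟨-, h⟩ := hT
    have h0 : rvmMain 0 T = 0 := by simp [rvmMain]
    rw [h0] at h
    push_cast at h
    linarith
  rw [he, Real.sInf_empty]

/-- At conductor `0` the fence is the single point `½`. [cite: BennettMartinOBryantRechnitzer2021, Theorem 1.1] -/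
theorem fence_level_zero_subset : fence 0 ⊆ {(1 / 2 : ℂ)} := by
  intro ρ hρ
  rcases mem_fence_iff.1 hρ with ⟨n, rfl⟩ | ⟨n, rfl⟩ <;>
    simp [fenceOrdinate_level_zero]

/-- **W7 as used by row S2: the fence of any conductor has finitely many points of height `≤ T`** (for `f ≥ 1`,
`T ≥ 0` it is p4's `fenceBelow f (fenceCount f T)`; empty for `T < 0`; `⊆ {½}` for `f = 0`).
[cite: BennettMartinOBryantRechnitzer2021, Theorem 1.1] -/
theorem fence_height_le_finite (f : ℕ) (T : ℝ) : Set.Finite {ρ : ℂ | ρ ∈ fence f ∧ |ρ.im| ≤ T} := by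
  rcases lt_or_ge T 0 with hT | hT
  · refine Set.Finite.subset (Set.finite_empty) ?_
    rintro ρ ⟨-, h⟩
    exact absurd (lt_of_le_of_lt h hT) (not_lt.2 (abs_nonneg _))
  rcases Nat.eq_zero_or_pos f with rfl | hf
  · exact (Set.finite_singleton (1 / 2 : ℂ)).subset fun ρ hρ => fence_level_zero_subset hρ.1
  · refine (fenceBelow f (fenceCount f T)).finite_toSet.subset ?_
    intro ρ hρ
    exact (mem_fenceBelow_iff hf hT).2 hρ

variable {D : ℕ} {χ : DirichletCharacter ℂ D}

/-- The zeros of a slot of `W(D, χ)` of height `≤ T` form a finite set (fence below `T` ∪ exceptional pair).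
[cite: Zhang2022LandauSiegel, §2 Assumption (A)] -/
theorem zeros_height_le_finite (q : ℕ) (ψ : DirichletCharacter ℂ q) (T : ℝ) :
    Set.Finite {ρ : ℂ | (world D χ).IsZero q ψ ρ ∧ |ρ.im| ≤ T} := by
  refine ((fence_height_le_finite ψ.conductor T).union (excPair_finite (D := D))).subset ?_
  rintro ρ ⟨hz, hT⟩
  rw [isZero_world_iff] at hz
  rcases hz with hf | ⟨-, hp⟩
  · exact Or.inl ⟨hf, hT⟩
  · exact Or.inr hp

/-! ### 2. Row S2 -/

/-- `finsum` of a natural-number-valued function over nested sets, the larger one finite, is monotone. [folklore] -/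
private theorem finsum_mem_nat_mono {s t : Set ℂ} (ht : t.Finite) (hst : s ⊆ t) (g : ℂ → ℕ) :
    ∑ᶠ ρ ∈ s, g ρ ≤ ∑ᶠ ρ ∈ t, g ρ := by
  have hs : s.Finite := ht.subset hst
  rw [finsum_mem_eq_finite_toFinset_sum g hs, finsum_mem_eq_finite_toFinset_sum g ht]
  exact Finset.sum_le_sum_of_subset_of_nonneg (Set.Finite.toFinset_subset_toFinset.mpr hst)
    (fun _ _ _ => Nat.zero_le _)

/-- **Row S2 on the world** (A4: `N(T, ψ)` monotone in `T`; the box count monotone in `H`, anti-monotone in `σ`) —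
for EVERY `D`, `χ`, `q`, `ψ`: the boxes are nested finite subsets of `fence ∪ {β₁, 1 − β₁}` and the multiplicity is a
natural number. The field `ZeroWorld.Menu.rowS2` verbatim. [cite: ThornerZaman2024LogFree, §1 (1.2)] -/
theorem world_rowS2 : ∀ (q : ℕ) (ψ : DirichletCharacter ℂ q) (σ σ' T T' : ℝ), σ' ≤ σ → T ≤ T' →
    (world D χ).stripCount q ψ T ≤ (world D χ).stripCount q ψ T' ∧
      (world D χ).charZeroCountRe q ψ σ T ≤ (world D χ).charZeroCountRe q ψ σ' T' := by
  intro q ψ σ σ' T T' hσ hT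
  have hfinT' := zeros_height_le_finite (D := D) (χ := χ) q ψ T'
  constructor
  · unfold ZeroWorld.stripCount
    refine finsum_mem_nat_mono (hfinT'.subset ?_) ?_ _
    · rintro ρ ⟨hz, -, -, hρ⟩; exact ⟨hz, hρ⟩
    · rintro ρ ⟨hz, h0, h1, hρ⟩; exact ⟨hz, h0, h1, le_trans hρ hT⟩
  · unfold ZeroWorld.charZeroCountRe ZeroWorld.zeroSetRe
    refine finsum_mem_nat_mono (hfinT'.subset ?_) ?_ _
    · rintro ρ ⟨hz, -, hρ⟩; exact ⟨hz, hρ⟩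
    · rintro ρ ⟨hz, hσρ, hρ⟩; exact ⟨hz, lt_of_le_of_lt hσ hσρ, le_trans hρ hT⟩

/-- **Row S2 in the exact binder shape of the hypothesis `hS2` of `menuConsistent_of_fenceRows`** (the
`log D ≥ 43 250` binder is carried and unused): `menuConsistent_of_fenceRows h04 h13 world_rowS2_hS2`.
[cite: ThornerZaman2024LogFree, §1 (1.2)] -/
theorem world_rowS2_hS2 : ∀ (D : ℕ) (χ : DirichletCharacter ℂ D), (43250 : ℝ) ≤ Real.log D →
    ∀ (q : ℕ) (ψ : DirichletCharacter ℂ q) (σ σ' T T' : ℝ), σ' ≤ σ → T ≤ T' →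
      (world D χ).stripCount q ψ T ≤ (world D χ).stripCount q ψ T' ∧
        (world D χ).charZeroCountRe q ψ σ T ≤ (world D χ).charZeroCountRe q ψ σ' T' :=
  fun _ _ _ => world_rowS2

/-- **The assembly with rows 04 and S2 discharged: `MenuConsistent` (E-057) from row 13 alone** — row 04 is
`DHMenuConsistentRow04Low.world_row04`, row S2 is `world_rowS2_hS2`, the constructor is
`DHMenuConsistentP4B.menuConsistent_of_fenceRows`. [cite: Zhang2022LandauSiegel, §2 Assumption (A)] -/
theorem menuConsistent_of_row13
    (h13 : ∀ (D : ℕ) (χ : DirichletCharacter ℂ D), χ.IsPrimitive → (43250 : ℝ) ≤ Real.log D →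
      ∀ (q : ℕ) [NeZero q], 1 < q → ∀ ψ : DirichletCharacter ℂ q, ψ.IsPrimitive → ∀ T : ℝ, 5 / 7 ≤ T →
        (bmorEll q T ≤ 1.567 → (world D χ).stripCount q ψ T = 0) ∧
        (1.567 < bmorEll q T →
          |((world D χ).stripCount q ψ T : ℝ) -
              (T / Real.pi * Real.log (q * T / (2 * Real.pi * Real.exp 1)) - (-1) ^ charParity ψ / 4)| ≤
            0.22737 * bmorEll q T + 2 * Real.log (1 + bmorEll q T) - 0.5)) :
    MenuConsistent :=
  menuConsistent_of_fenceRows (fun _ _ hprim hL => world_row04 hL hprim) h13 world_rowS2_hS2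

end Literature.NumberTheory.LFunctions.Zhang2022.DH

end
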